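import Mathlib.MeasureTheory.Measure.Real
import HarnessLib

/-!
# Elementary `μ.real` bookkeeping for the frontier-row cut files (route `PercNearOneGluingNoHeavy`, supports-only; prim-l12-p6 g16)

When a four-point row is glued across a cut vertex, every glued event has the shape `S ∖ ((S ∩ H₁ ∪ … ∪ S ∩ H_k) ∩ E)` with the `Hᵢ`
pairwise disjoint on `S` and `E` (a far-side event) independent of the near side; its probability is `μ(S) − (Σ μ(S ∩ Hᵢ))·μ(E)`.
These lemmas (for an arbitrary finite measure, all sets measurable by hypothesis) replace the ad-hoc `mOne/mTwo/dj2` blocks of the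
gen-15 files.  No definitions, no named facts, no sorries.
-/

namespace Summit.CriticalPhenomena.PercolationContinuityZ3.Theorems.FrontierDecRows

open MeasureTheory

variable {Ω : Type*} [MeasurableSpace Ω] (μ : Measure Ω) [IsFiniteMeasure μ]

/-- `μ(S ∩ Hᶜ) = μ(S) − μ(S ∩ H)`. [folklore] -/
theorem real_inter_compl (hm : ∀ A : Set Ω, MeasurableSet A) (S H : Set Ω) :
    μ.real (S ∩ Hᶜ) = μ.real S - μ.real (S ∩ H) := by
  have e : S ∩ Hᶜ = S \ (S ∩ H) := by ext ω; simp only [Set.mem_inter_iff, Set.mem_compl_iff, Set.mem_sdiff]; tauto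
  rw [e, measureReal_sdiff Set.inter_subset_left (hm _)]

/-- Two complements, disjoint on `S`. [folklore] -/
theorem real_inter_compl₂ (hm : ∀ A : Set Ω, MeasurableSet A) (S H H' : Set Ω) (hd : ∀ ω, ω ∈ S → ω ∈ H → ω ∈ H' → False) :
    μ.real (S ∩ Hᶜ ∩ H'ᶜ) = μ.real S - (μ.real (S ∩ H) + μ.real (S ∩ H')) := by
  have e : S ∩ Hᶜ ∩ H'ᶜ = S \ ((S ∩ H) ∪ (S ∩ H')) := by
    ext ω; simp only [Set.mem_inter_iff, Set.mem_compl_iff, Set.mem_sdiff, Set.mem_union]; tauto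
  have hdj : Disjoint (S ∩ H) (S ∩ H') := Set.disjoint_left.2 fun ω h1 h2 => hd ω h1.1 h1.2 h2.2
  rw [e, measureReal_sdiff (fun ω hω => by rcases hω with h1 | h2 <;> [exact h1.1; exact h2.1]) (hm _), measureReal_union hdj (hm _)]

/-- Three complements, pairwise disjoint on `S`. [folklore] -/
theorem real_inter_compl₃ (hm : ∀ A : Set Ω, MeasurableSet A) (S H H' H'' : Set Ω) (h1 : ∀ ω, ω ∈ S → ω ∈ H → ω ∈ H' → False)
    (h2 : ∀ ω, ω ∈ S → ω ∈ H → ω ∈ H'' → False) (h3 : ∀ ω, ω ∈ S → ω ∈ H' → ω ∈ H'' → False) :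
    μ.real (S ∩ Hᶜ ∩ H'ᶜ ∩ H''ᶜ) = μ.real S - (μ.real (S ∩ H) + μ.real (S ∩ H') + μ.real (S ∩ H'')) := by
  have e : S ∩ Hᶜ ∩ H'ᶜ ∩ H''ᶜ = S \ ((S ∩ H) ∪ (S ∩ H') ∪ (S ∩ H'')) := by
    ext ω; simp only [Set.mem_inter_iff, Set.mem_compl_iff, Set.mem_sdiff, Set.mem_union]; tauto
  have d1 : Disjoint (S ∩ H) (S ∩ H') := Set.disjoint_left.2 fun ω p q => h1 ω p.1 p.2 q.2
  have d2 : Disjoint ((S ∩ H) ∪ (S ∩ H')) (S ∩ H'') := by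
    rw [Set.disjoint_union_left]
    exact ⟨Set.disjoint_left.2 fun ω p q => h2 ω p.1 p.2 q.2, Set.disjoint_left.2 fun ω p q => h3 ω p.1 p.2 q.2⟩
  rw [e, measureReal_sdiff (fun ω hω => by
    rcases hω with (p | q) | r
    · exact p.1
    · exact q.1
    · exact r.1) (hm _), measureReal_union d2 (hm _), measureReal_union d1 (hm _)]

/-- One removed block: `μ(S ∖ ((S ∩ H) ∩ E)) = μ(S) − μ(S ∩ H)·μ(E)` when `μ((S ∩ H) ∩ E) = μ(S ∩ H)·μ(E)`. [folklore] -/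
theorem real_sdiff_block₁ (hm : ∀ A : Set Ω, MeasurableSet A) (S H E : Set Ω) (hi : μ.real ((S ∩ H) ∩ E) = μ.real (S ∩ H) * μ.real E) :
    μ.real (S \ ((S ∩ H) ∩ E)) = μ.real S - μ.real (S ∩ H) * μ.real E := by
  rw [measureReal_sdiff (fun ω hω => hω.1.1) (hm _), hi]

/-- Two removed blocks, disjoint on `S`. [folklore] -/
theorem real_sdiff_block₂ (hm : ∀ A : Set Ω, MeasurableSet A) (S H H' E : Set Ω) (hd : ∀ ω, ω ∈ S → ω ∈ H → ω ∈ H' → False)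
    (hi : μ.real ((S ∩ H) ∩ E) = μ.real (S ∩ H) * μ.real E) (hi' : μ.real ((S ∩ H') ∩ E) = μ.real (S ∩ H') * μ.real E) :
    μ.real (S \ (((S ∩ H) ∪ (S ∩ H')) ∩ E)) = μ.real S - (μ.real (S ∩ H) + μ.real (S ∩ H')) * μ.real E := by
  have hdj : Disjoint ((S ∩ H) ∩ E) ((S ∩ H') ∩ E) := Set.disjoint_left.2 fun ω p q => hd ω p.1.1 p.1.2 q.1.2
  rw [Set.union_inter_distrib_right, measureReal_sdiff (fun ω hω => by
    rcases hω with p | q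
    · exact p.1.1
    · exact q.1.1) (hm _), measureReal_union hdj (hm _), hi, hi']
  ring

/-- Three removed blocks, pairwise disjoint on `S`. [folklore] -/
theorem real_sdiff_block₃ (hm : ∀ A : Set Ω, MeasurableSet A) (S H H' H'' E : Set Ω) (h1 : ∀ ω, ω ∈ S → ω ∈ H → ω ∈ H' → False)
    (h2 : ∀ ω, ω ∈ S → ω ∈ H → ω ∈ H'' → False) (h3 : ∀ ω, ω ∈ S → ω ∈ H' → ω ∈ H'' → False)
    (hi : μ.real ((S ∩ H) ∩ E) = μ.real (S ∩ H) * μ.real E) (hi' : μ.real ((S ∩ H') ∩ E) = μ.real (S ∩ H') * μ.real E)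
    (hi'' : μ.real ((S ∩ H'') ∩ E) = μ.real (S ∩ H'') * μ.real E) :
    μ.real (S \ (((S ∩ H) ∪ (S ∩ H') ∪ (S ∩ H'')) ∩ E)) =
      μ.real S - (μ.real (S ∩ H) + μ.real (S ∩ H') + μ.real (S ∩ H'')) * μ.real E := by
  have d1 : Disjoint ((S ∩ H) ∩ E) ((S ∩ H') ∩ E) := Set.disjoint_left.2 fun ω p q => h1 ω p.1.1 p.1.2 q.1.2
  have d2 : Disjoint (((S ∩ H) ∩ E) ∪ ((S ∩ H') ∩ E)) ((S ∩ H'') ∩ E) := by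
    rw [Set.disjoint_union_left]
    exact ⟨Set.disjoint_left.2 fun ω p q => h2 ω p.1.1 p.1.2 q.1.2, Set.disjoint_left.2 fun ω p q => h3 ω p.1.1 p.1.2 q.1.2⟩
  rw [Set.union_inter_distrib_right, Set.union_inter_distrib_right, measureReal_sdiff (fun ω hω => by
    rcases hω with (p | q) | r
    · exact p.1.1
    · exact q.1.1
    · exact r.1.1) (hm _), measureReal_union d2 (hm _), measureReal_union d1 (hm _), hi, hi', hi'']
  ring

end Summit.CriticalPhenomena.PercolationContinuityZ3.Theorems.FrontierDecRows
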